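import Mathlib
import HarnessLib
import Summits.KontsevichZagierPeriods.KontsevichZagierPeriods.Theorems.LinRedNormalFormDihedralNormalFormStubNestedReductionAux10
import Summits.KontsevichZagierPeriods.KontsevichZagierPeriods.Theorems.LinRedNormalFormDihedralNormalFormStubNestedReductionAux12

/-!
# `DihedralNormalForm`, line `torus-descent-sum-shadow`, stub `stub_nestedReduction` — Aux 13

Support file for the stub `stub_nestedReduction` (THEOREM N) of the crux `DihedralNormalForm`
(stmt-KontsevichZagierPeriods-3912, route `LinRedNormalForm`): **phase (N3) — peeling numerator
factors** (`Nested.levelB`).  A convergent prefix-nested atom whose kernel exponents are `≥ −1`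
and singleton exponents `≥ 0` reduces to the target: by induction on
`ν = Σ_{j ≠ 0}(e 0 j)⁺ + Σ_l (e l l)⁺`, one shift move (rule 1b) peels a factor `(1 − x_{[0,j]})`
or `(1 − x_l)` (`[a, e] = [a, e − δ_I] − [a + 𝟙_I, e − δ_I]`, both peeled atoms again reduced,
hence convergent by `Nested.alphaS_nonneg_of_reduced` and the sufficiency hypothesis `hsuf`);
at `ν = 0` the atom is a simple prefix chain and phase (N4) (`Nested.levelC`, Aux 12) applies.
Also: the glue identifying the terms of the axis Newton–Leibniz move with shifted atoms.

References: M. Kontsevich, D. Zagier, *Periods* (2001), §1.2.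
-/

noncomputable section

open MeasureTheory Set

namespace Summit.KontsevichZagierPeriods.DihedralNormalForm.TorusDescent

open Literature.NumberTheory.Transcendental

namespace Nested

variable {k m : ℕ}

/-! ## Glue between the exponent updates -/

/-- `E − δ_{ij}` is `eadd E i j (−1)`. -/
theorem esub_eq_eadd (E : Fin (m + 1) → Fin (m + 1) → ℤ) (i j : Fin (m + 1)) :
    esub E i j = eadd E i j (-1) := by
  funext i' j'
  rw [esub, eadd_apply]
  split_ifs <;> ring

/-- Lowering then raising the same exponent. -/
theorem eadd_eadd_cancel (e : Fin k → Fin k → ℤ) (i j : Fin k) (c : ℤ) :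
    eadd (eadd e i j c) i j (-c) = e := by
  funext i' j'
  rw [eadd_apply, eadd_apply]
  split_ifs <;> ring

/-- `(a + 𝟙_p) − 𝟙_p = a`. -/
theorem adown_aup (a : Fin (m + 1) → ℕ) (p : Fin (m + 1)) : adown (aup a p p) p = a := by
  funext l
  unfold adown aup
  by_cases h : l = p
  · subst h; simp
  · rw [Function.update_of_ne h, if_neg (fun h' => h (le_antisymm h'.2 h'.1)), add_zero]

/-- `(a + 𝟙_p) − 𝟙_p + 𝟙_{[i,j]} = a + 𝟙_{[i,j]}` for `[i,j] ∋ p`. -/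
theorem aterm_aup (a : Fin (m + 1) → ℕ) {p i j : Fin (m + 1)} (hip : i ≤ p) (hpj : p ≤ j) :
    aterm (aup a p p) p i j = aup a i j := by
  funext l
  unfold aterm aup
  by_cases h : l = p
  · subst h; simp [hip, hpj]
  · rw [if_neg (fun h' => h (le_antisymm h'.2 h'.1)), add_zero]
    by_cases h2 : i ≤ l ∧ l ≤ j
    · rw [if_pos ⟨h2.1, h2.2, h⟩, if_pos h2]
    · rw [if_neg (fun h' => h2 ⟨h'.1, h'.2.1⟩), if_neg h2]

/-- Negating the coefficient negates the atom. -/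
theorem atomQ_neg (q : ℚ) (a : Fin k → ℕ) (e : Fin k → Fin k → ℤ) (x : Fin k → ℝ) :
    atomQ k (-q) a e x = -atomQ k q a e x := by
  rw [show -q = (-1) * q by ring, atomQ_mul]; simp

/-! ## Phase (N3): peeling numerator factors -/

/-- One peel: the shift move read as `[a, e] = [a, e − δ_I] − [a + 𝟙_I, e − δ_I]`, with the two
peeled atoms reduced by hypothesis. -/
theorem peel_step {q : ℚ} {a : Fin (m + 1) → ℕ} {e : Fin (m + 1) → Fin (m + 1) → ℤ} {i₀ j₀ : Fin (m + 1)}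
    (hij : i₀ ≤ j₀) (s : KZ.IntegralRep (m + 1)) (hs : s.domain = ocube (m + 1))
    (hi : EqOn s.integrand (atomQ (m + 1) q a e) s.domain)
    (h₁ : IntegrableOn (atomQ (m + 1) q a (eadd e i₀ j₀ (-1))) (ocube (m + 1)))
    (h₂ : IntegrableOn (atomQ (m + 1) q (aup a i₀ j₀) (eadd e i₀ j₀ (-1))) (ocube (m + 1)))
    (red₁ : ∃ M ∈ Target (m + 1), KZ.of (atomRep (m + 1) q a (eadd e i₀ j₀ (-1)) h₁) - M ∈ KZ.relations)
    (red₂ : ∃ M ∈ Target (m + 1),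
      KZ.of (atomRep (m + 1) q (aup a i₀ j₀) (eadd e i₀ j₀ (-1)) h₂) - M ∈ KZ.relations) :
    ∃ M ∈ Target (m + 1), KZ.of s - M ∈ KZ.relations := by
  set s₁ := atomRep (m + 1) q a (eadd e i₀ j₀ (-1)) h₁ with hs₁
  set s₂ := atomRep (m + 1) q (aup a i₀ j₀) (eadd e i₀ j₀ (-1)) h₂ with hs₂
  have hrel : KZ.of s₁ - KZ.of s₂ - KZ.of s ∈ KZ.relations :=
    shift_mem_relations q a (eadd e i₀ j₀ (-1)) hij s₁ s₂ s rfl rfl hs (fun _ _ => rfl) (fun _ _ => rfl)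
      (fun x hx => by
        have h := eadd_eadd_cancel e i₀ j₀ (-1)
        rw [neg_neg] at h
        rw [hi hx, h])
  obtain ⟨M₁, hM₁, r₁⟩ := red₁
  obtain ⟨M₂, hM₂, r₂⟩ := red₂
  refine ⟨M₁ - M₂, sub_mem hM₁ hM₂, ?_⟩
  have := sub_mem (sub_mem r₁ r₂) hrel
  convert this using 1
  abel

/-- **Phase (N3).**  Reduced prefix-nested atoms (kernel exponents `≥ −1`, singleton exponents
`≥ 0`) reduce to the target. -/
theorem levelB
    (hsuf : ∀ (q : ℚ) (a : Fin (m + 1) → ℕ) (e : Fin (m + 1) → Fin (m + 1) → ℤ),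
      (∀ i j : Fin (m + 1), i ≤ j → 0 ≤ alphaS e i j) → IntegrableOn (atomQ (m + 1) q a e) (ocube (m + 1))) :
    ∀ (N : ℕ) (e : Fin (m + 1) → Fin (m + 1) → ℤ), nu e = N →
      (∀ i j : Fin (m + 1), i < j → e i j ≠ 0 → (i : ℕ) = 0) →
      (∀ i j : Fin (m + 1), i < j → -1 ≤ e i j) → (∀ l : Fin (m + 1), 0 ≤ e l l) →
      ∀ (q : ℚ) (a : Fin (m + 1) → ℕ) (s : KZ.IntegralRep (m + 1)), s.domain = ocube (m + 1) →
        EqOn s.integrand (atomQ (m + 1) q a e) s.domain →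
        ∃ M ∈ Target (m + 1), KZ.of s - M ∈ KZ.relations := by
  intro N
  induction N using Nat.strong_induction_on with
  | _ N IH =>
  intro e hN hPN hker hdiag q a s hs hi
  by_cases h0 : nu e = 0
  · -- a simple prefix chain: phase (N4)
    obtain ⟨P, hP0, hP⟩ := exists_eP_of_reduced hPN hker hdiag h0
    exact levelC hsuf _ P rfl hP0 q a s hs (by rw [← atomQ_congr hP]; exact hi)
  -- a numerator factor to peel
  have hsum : (∑ j : Fin (m + 1), if (j : ℕ) ≠ 0 then (e 0 j).toNat else 0) ≠ 0 ∨
      (∑ l : Fin (m + 1), (e l l).toNat) ≠ 0 := by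
    by_contra h
    push Not at h
    exact h0 (by unfold nu; omega)
  rcases hsum with hk | hd
  · -- a numerator kernel chord `[0, j₀]`
    obtain ⟨j₀, -, hj₀⟩ := Finset.exists_ne_zero_of_sum_ne_zero hk
    have hj : (j₀ : ℕ) ≠ 0 := by intro h; simp [h] at hj₀
    rw [if_pos hj] at hj₀
    have he : 1 ≤ e 0 j₀ := by
      have : (e 0 j₀).toNat ≠ 0 := hj₀
      omega
    have hPN' : ∀ i j : Fin (m + 1), i < j → eadd e 0 j₀ (-1) i j ≠ 0 → (i : ℕ) = 0 := by
      intro i j hij hne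
      rw [eadd_apply] at hne
      by_cases h : i = 0 ∧ j = j₀
      · rw [h.1]; rfl
      · rw [if_neg h, add_zero] at hne; exact hPN i j hij hne
    have hker' : ∀ i j : Fin (m + 1), i < j → -1 ≤ eadd e 0 j₀ (-1) i j := by
      intro i j hij
      rw [eadd_apply]
      have := hker i j hij
      split_ifs with h
      · rw [h.1, h.2]; omega
      · omega
    have hdiag' : ∀ l : Fin (m + 1), 0 ≤ eadd e 0 j₀ (-1) l l := by
      intro l
      rw [eadd_apply, if_neg, add_zero]
      · exact hdiag l
      · rintro ⟨h1, h2⟩; exact hj (by rw [← h2, h1]; rfl)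
    have hα' := alphaS_nonneg_of_reduced hPN' hker' hdiag'
    have hlt : nu (eadd e 0 j₀ (-1)) < N := hN ▸ nu_peel_kernel_lt hj he
    exact peel_step (Fin.zero_le j₀) s hs hi (hsuf _ _ _ hα') (hsuf _ _ _ hα')
      (IH _ hlt _ rfl hPN' hker' hdiag' q a _ rfl (fun _ _ => rfl))
      (IH _ hlt _ rfl hPN' hker' hdiag' q _ _ rfl (fun _ _ => rfl))
  · -- a numerator singleton factor `(1 − x_{l₀})`
    obtain ⟨l₀, -, hl₀⟩ := Finset.exists_ne_zero_of_sum_ne_zero hd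
    have he : 1 ≤ e l₀ l₀ := by
      have : (e l₀ l₀).toNat ≠ 0 := hl₀
      omega
    have hPN' : ∀ i j : Fin (m + 1), i < j → eadd e l₀ l₀ (-1) i j ≠ 0 → (i : ℕ) = 0 := by
      intro i j hij hne
      rw [eadd_apply, if_neg, add_zero] at hne
      · exact hPN i j hij hne
      · rintro ⟨h1, h2⟩; rw [h1, h2] at hij; exact lt_irrefl _ hij
    have hker' : ∀ i j : Fin (m + 1), i < j → -1 ≤ eadd e l₀ l₀ (-1) i j := by
      intro i j hij
      rw [eadd_apply, if_neg, add_zero]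
      · exact hker i j hij
      · rintro ⟨h1, h2⟩; rw [h1, h2] at hij; exact lt_irrefl _ hij
    have hdiag' : ∀ l : Fin (m + 1), 0 ≤ eadd e l₀ l₀ (-1) l l := by
      intro l
      rw [eadd_apply]
      have := hdiag l
      split_ifs with h
      · rw [h.1]; omega
      · omega
    have hα' := alphaS_nonneg_of_reduced hPN' hker' hdiag'
    have hlt : nu (eadd e l₀ l₀ (-1)) < N := hN ▸ nu_peel_diag_lt he
    exact peel_step le_rfl s hs hi (hsuf _ _ _ hα') (hsuf _ _ _ hα')
      (IH _ hlt _ rfl hPN' hker' hdiag' q a _ rfl (fun _ _ => rfl))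
      (IH _ hlt _ rfl hPN' hker' hdiag' q _ _ rfl (fun _ _ => rfl))

end Nested

/-- **Registered sub-goal `stub_nestedReductionAux13`**: phase (N3) of Theorem N: reduced prefix-nested atoms reduce to words + SD1-directed + lower-dimensional atoms (`Nested.levelB`), given sufficiency of the convergence criterion. -/
theorem stub_nestedReductionAux13 : ∀ (m : ℕ), (∀ (q : ℚ) (a : Fin (m + 1) → ℕ) (e : Fin (m + 1) → Fin (m + 1) → ℤ), (∀ i j : Fin (m + 1), i ≤ j → 0 ≤ ((j : ℤ) - (i : ℤ)) + ∑ i' : Fin (m + 1), ∑ j' : Fin (m + 1), if i ≤ i' ∧ i' ≤ j' ∧ j' ≤ j then e i' j' else 0) → MeasureTheory.IntegrableOn (fun x : Fin (m + 1) → ℝ => (q : ℝ) * ((∏ i : Fin (m + 1), x i ^ a i) * ∏ i : Fin (m + 1), ∏ j : Fin (m + 1), if i ≤ j then (1 - (∏ l : Fin (m + 1), if i ≤ l ∧ l ≤ j then x l else 1)) ^ e i j else 1)) {x : Fin (m + 1) → ℝ | ∀ i, x i ∈ Set.Ioo (0:ℝ) 1} MeasureTheory.volume) → ∀ (N : ℕ)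 (e : Fin (m + 1) → Fin (m + 1) → ℤ), ((∑ j : Fin (m + 1), if (j : ℕ) ≠ 0 then (e 0 j).toNat else 0) + ∑ l : Fin (m + 1), (e l l).toNat) = N → (∀ i j : Fin (m + 1), i < j → e i j ≠ 0 → (i : ℕ) = 0) → (∀ i j : Fin (m + 1), i < j → -1 ≤ e i j) → (∀ l : Fin (m + 1), 0 ≤ e l l) → ∀ (q : ℚ) (a : Fin (m + 1) → ℕ) (s : Literature.NumberTheory.Transcendental.KZ.IntegralRep (m + 1)), s.domain = {x : Fin (m + 1) → ℝ | ∀ i, x i ∈ Set.Ioo (0:ℝ) 1} → Set.EqOn s.integrand (fun x => (q : ℝ) * ((∏ i : Fin (m + 1), x i ^ a i) * ∏ i : Fin (m + 1), ∏ j : Fin (m + 1), if i ≤ j then (1 - (∏ l : Fin (m + 1), if i ≤ l ∧ l ≤ j then x l else 1)) ^ e i j else 1)) s.domain → ∃ M ∈ AddSubgroup.closure ({z : Literature.NumberTheory.Transcendental.KZ.FormalRep | ∃ (q : ℚ) (ε : Fin (m + 1) → Bool) (s : Literature.NumberTheory.Transcendental.KZ.IntegralRep (m + 1)), s.domain = {x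 : Fin (m + 1) → ℝ | ∀ i, x i ∈ Set.Ioo (0:ℝ) 1} ∧ Set.EqOn s.integrand (fun x => (q : ℝ) * ((∏ i : Fin (m + 1), x i ^ (m + 1 - 1 - (i : ℕ))) * ∏ i : Fin (m + 1), if ε i then 1 / (1 - (∏ l : Fin (m + 1), if l ≤ i then x l else 1)) else 1 / (∏ l : Fin (m + 1), if l ≤ i then x l else 1))) s.domain ∧ z = Literature.NumberTheory.Transcendental.KZ.of s} ∪ {z : Literature.NumberTheory.Transcendental.KZ.FormalRep | ∃ (q : ℚ) (a : Fin (m + 1) → ℕ) (e : Fin (m + 1) → Fin (m + 1) → ℤ) (s : Literature.NumberTheory.Transcendental.KZ.IntegralRep (m + 1)), (∃ lam : Fin (m + 1) → ℤ, (∀ l : Fin (m + 1), lam l = 0 ∨ lam l = 1 ∨ lam l = -1) ∧ (∃ p : Fin (m + 1), lam p = -1) ∧ (Finset.univ.filter (fun l : Fin (m + 1) => lam l = 1)).card ≤ 1 ∧ (∀ i j : Fin (m + 1), i ≤ j → e i j ≠ 0 → (∑ l : Fin (m + 1), if i ≤ l ∧ l ≤ j then lam l else 0) = 0) ∧ (∑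 l : Fin (m + 1), lam l * ((a l : ℤ) + 1)) ≠ 0) ∧ s.domain = {x : Fin (m + 1) → ℝ | ∀ i, x i ∈ Set.Ioo (0:ℝ) 1} ∧ Set.EqOn s.integrand (fun x => (q : ℝ) * ((∏ i : Fin (m + 1), x i ^ a i) * ∏ i : Fin (m + 1), ∏ j : Fin (m + 1), if i ≤ j then (1 - (∏ l : Fin (m + 1), if i ≤ l ∧ l ≤ j then x l else 1)) ^ e i j else 1)) s.domain ∧ z = Literature.NumberTheory.Transcendental.KZ.of s} ∪ {z : Literature.NumberTheory.Transcendental.KZ.FormalRep | ∃ d : ℕ, d < m + 1 ∧ z ∈ {z : Literature.NumberTheory.Transcendental.KZ.FormalRep | ∃ (q : ℚ) (a : Fin d → ℕ) (e : Fin d → Fin d → ℤ) (s : Literature.NumberTheory.Transcendental.KZ.IntegralRep d), s.domain = {x : Fin d → ℝ | ∀ i, x i ∈ Set.Ioo (0:ℝ) 1} ∧ Set.EqOn s.integrand (fun x => (q : ℝ) * ((∏ i : Fin d, x i ^ a i) * ∏ i : Fin d, ∏ j : Fin d, if i ≤ j then (1 - (∏ l : Fin d, if i ≤ l ∧ l ≤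 j then x l else 1)) ^ e i j else 1)) s.domain ∧ z = Literature.NumberTheory.Transcendental.KZ.of s}}), Literature.NumberTheory.Transcendental.KZ.of s - M ∈ Literature.NumberTheory.Transcendental.KZ.relations :=
  fun _ hsuf N e hN h1 h2 h3 q a s hs hi =>
    Nested.levelB hsuf N e hN h1 h2 h3 q a s hs hi

end Summit.KontsevichZagierPeriods.DihedralNormalForm.TorusDescent
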